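import Literature.AnabelianGeometry.SemiGraphs.Corollary27iOfDoubleCosets

/-!
# [SemiAnbd] Cor. 2.7 (i) from a SUPPLIED covering carrying (D3) — proof

Mochizuki, *Semi-graphs of anabelioids*, Publ. RIMS **42** (2006) 221–322, Cor. 2.7 (i) p. 30
[cite: MochizukiSemiAnbd2006, Cor. 2.7(i) p.30]: for a connected, quasi-coherent graph of anabelioids
`𝒢` and a connected sub-semi-graph `ℍ` all of whose vertices are elevated, `C_{Π_𝒢}(Π_ℍ) = Π_ℍ`; in
particular `C_{Π_𝒢}(Π_v) = Π_v` for elevated `v`.  abc-iut cell, layer L3, row «C27i-cov» (abc-iut-w4-d071):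
abc-iut-L3-d3's reduction `isCommensurablyTerminal_piHToPi_of_dictionary`
(`CommensurableTerminalityProofs.lean`) takes the covering `𝒢′ → 𝒢` attached to a Galois object from the
EXISTENCE fact `exists_finiteEtaleCoveringGlobal` and then applies the dictionary item (D3)
`covering_subgraphComponents_doubleCosets` — stated for EVERY finite étale covering `φ` (local ∧ global ∧
vertex-aligned) — to that anonymous covering.  For an abstract `φ` the group clauses (P3)/(P4) of (D3)
have no known route (abc-iut-L3-d3, STATUS 2026-08-26T01:58:15Z: they are construction-side facts of
print's covering `𝒢_A → 𝒢`), so the programme proves (D3) AT the constructed covering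
`A.coveringHomCan : 𝒢_A → 𝒢` only.  This PROOF-ONLY file (no `def`) re-proves the engine with the
covering SUPPLIED together with (D3) for it: the single hypothesis `hsup` hands, for every connected `𝒢`
(with a vertex) and every GALOIS object `A` of `B(𝒢)` (print, p. 30: "a connected finite Galois étale
covering"; `B(𝒢)` is a Galois category by abc-iut-L3-t9's `galoisCategory_bObj`), SOME covering `φ : 𝒢′ → 𝒢` attached to `A` locally
(`IsFiniteEtaleCoveringOf`), globally (`IsGlobalCoveringOf`) and with aligned branches
(`IsBranchAligned`), together with the body of (D3) for this `φ` (verbatim, guarded by `𝒢′` connected).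
The proof is abc-iut-L3-d3's, step for step (p. 30: open normal `N` missing `g Π_ℍ`; pointed Galois
object `(A, a)` with `Stab(a) ⊆ N`; the supplied covering, connected (D8), a graph, quasi-coherent (D5),
a vertex `v′` over `v` (D9), elevated (D6), `Π′ = Stab` (D1); components of `φ⁻¹(ℍ)` ↔ double cosets
(supplied (D3)); pigeonhole via Prop. 2.6; Prop. 2.6 for `(ℋ″ ∋ v′, 𝕂″)` contradicts `g ∈ C(Π_ℍ)`), with
the seven discharged facts supplied BY NAME exactly as in `Corollary27iOfDoubleCosets.lean`:
`proposition_2_6_holds` (abc-iut-L6-t18), (D0) `covering_fiberFunctor_holds`, (D1)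
`covering_decompositionGroup_holds`, (D5) `covering_isQuasiCoherent_holds`, (D6)
`covering_isElevated_holds`, (D8) `covering_isConnected_holds`, (D9) `covering_vertexMap_surjective_holds`.
The existential packaging is deliberate: the engine substitutes `v := φ v′`, which needs `φ` to be a
local constant, not a term mentioning the Galois object chosen from `v`.  Consumers: the specialisation
to `φ := A.coveringHomCan` (`Corollary27iAtCoveringHomCan.lean`) and, trivially, the abstract version
(`hsup` from `exists_finiteEtaleCoveringGlobal` ∧ (D3) — which is the already-landed
`corollary_2_7_i_of_subgraphComponents_doubleCosets`, `Corollary27iOfDoubleCosets.lean`, not restated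
here).  Honest framing: conditional on `hsup`; typed ≠ proved for (D3); nothing here bears on [IUTchIII]
Cor. 3.12.  (Author abc-iut-w4-d071 gen 2, v2 bytes cbba825f88dd4602; proxy-filed by abc-iut-w4-d076 with
the one duplicate consistency-check theorem dropped per the gate's `dedup.landed` rule — otherwise
byte-identical.)
-/

namespace Literature.AnabelianGeometry.SemiGraphs

open CategoryTheory CategoryTheory.PreGaloisCategory
open Literature.AnabelianGeometry.Anabelioids
open scoped Pointwise

namespace SemiGraphOfAnabelioids

universe v₁ u₁ u

/-- **The sub-semi-graph clause of [SemiAnbd] Cor. 2.7 (i), from a SUPPLIED covering carrying (D3)**: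
if for every connected `𝒢` and every Galois `A ∈ B(𝒢)` some finite étale covering `φ : 𝒢′ → 𝒢` attached to `A`
(locally, globally, branch-aligned) is given TOGETHER WITH the body of the dictionary item (D3)
(`covering_subgraphComponents_doubleCosets`) for this `φ`, then for `𝒢` a connected quasi-coherent graph
of anabelioids, `ℍ ∋ v` a connected sub-graph all of whose vertices are elevated, and any basepoint
through `v`, the image `Π_ℍ ⊆ Π_𝒢` is commensurably terminal.  abc-iut-L3-d3's proof
(`isCommensurablyTerminal_piHToPi_of_dictionary`) with the covering taken from `hsup` instead of
`exists_finiteEtaleCoveringGlobal` ∧ (D3), and Prop. 2.6, (D0), (D1), (D5), (D6), (D8), (D9) supplied by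
their kernel theorems. [cite: MochizukiSemiAnbd2006, Cor. 2.7(i) p.30] -/
theorem isCommensurablyTerminal_piHToPi_of_coveringSupply
    (hsup : ∀ (𝒢 : SemiGraphOfAnabelioids.{v₁, u₁, u}) (A : 𝒢.BObj) (hc : 𝒢.IsConnected),
      Nonempty 𝒢.graph.Vertex → @IsGalois 𝒢.BObj _ (𝒢.galoisCategory_bObj hc) A →
      ∃ (𝒢' : SemiGraphOfAnabelioids.{v₁, u₁, u}) (φ : Hom 𝒢' 𝒢),
        φ.IsFiniteEtaleCoveringOf A ∧ φ.IsGlobalCoveringOf A ∧ φ.IsBranchAligned ∧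
        (𝒢'.IsConnected →
          ∀ (v' : 𝒢'.graph.Vertex) (F' : 𝒢'.V v' ⥤ FintypeCat.{v₁}) [FiberFunctor F']
            (F : 𝒢.V (φ.base.vertexMap v') ⥤ FintypeCat.{v₁}) [FiberFunctor F]
            (e : (φ.φV v').pullback ⋙ F' ≅ F)
            (H : 𝒢.graph.Subgraph), H.toSemiGraph.IsConnected → H.toSemiGraph.IsGraph →
            ∀ (hv : φ.base.vertexMap v' ∈ H.verts),
            let v := φ.base.vertexMap v'
            let ι : 𝒢'.Pi v' F' →* 𝒢.Pi v F :=
              (Aut.autMulEquivOfIso (Functor.isoWhiskerLeft (𝒢.ρ v) e)).toMonoidHom.comp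
                (pi1Map φ.pullbackFunctor (𝒢'.ρ v' ⋙ F'))
            let PH : Subgroup (𝒢.Pi v F) := (𝒢.piHToPi H ⟨v, hv⟩ F).range
            ∀ x₀ : (𝒢.ρ v ⋙ F).obj A, ι.range = MulAction.stabilizer (𝒢.Pi v F) x₀ →
              ∃ d : {K : 𝒢'.graph.Subgraph // φ.IsPreimageComponent H K} → 𝒢.Pi v F,
                Function.Bijective (fun K => DoubleCoset.mk PH ι.range (d K)) ∧
                (∃ K₀ : {K : 𝒢'.graph.Subgraph // φ.IsPreimageComponent H K}, v' ∈ K₀.1.verts) ∧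
                (∀ (K : {K : 𝒢'.graph.Subgraph // φ.IsPreimageComponent H K}) (hK : v' ∈ K.1.verts),
                  d K ∈ ι.range ∧
                    (ι.comp (𝒢'.piHToPi K.1 ⟨v', hK⟩ F')).range = ι.range ⊓ PH) ∧
                ∀ (K : {K : 𝒢'.graph.Subgraph // φ.IsPreimageComponent H K})
                  (w'' : K.1.toSemiGraph.Vertex) (F'' : 𝒢'.V w''.1 ⥤ FintypeCat.{v₁})
                  [FiberFunctor F''] (α : 𝒢'.ρ w''.1 ⋙ F'' ≅ 𝒢'.ρ v' ⋙ F'),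
                  ∃ g : 𝒢.Pi v F,
                    (ι.comp ((Aut.autMulEquivOfIso α).toMonoidHom.comp
                      (𝒢'.piHToPi K.1 w'' F''))).range = ι.range ⊓ ConjAct.toConjAct g⁻¹ • PH))
    (𝒢 : SemiGraphOfAnabelioids.{v₁, u₁, u}) (hc : 𝒢.IsConnected) (hg : 𝒢.IsGraphOfAnabelioids)
    (hq : 𝒢.IsQuasiCoherent) (H : 𝒢.graph.Subgraph) (hH : H.toSemiGraph.IsConnected)
    (hHg : H.toSemiGraph.IsGraph) (hel : ∀ w : H.toSemiGraph.Vertex, 𝒢.IsElevated w.1)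
    (v : 𝒢.graph.Vertex) (hvH : v ∈ H.verts) (F : 𝒢.V v ⥤ FintypeCat.{v₁}) [FiberFunctor F] :
    AbsoluteAnabelian.IsCommensurablyTerminal (𝒢.piHToPi H ⟨v, hvH⟩ F).range := by
  set PH : Subgroup (𝒢.Pi v F) := (𝒢.piHToPi H ⟨v, hvH⟩ F).range with hPH
  refine ⟨le_antisymm ?_ (le_commensurator_self PH)⟩
  intro g hgC
  by_contra hgPH
  -- (1) an open normal subgroup `N` with `g ∉ Π_ℍ N`
  obtain ⟨N, hN⟩ := exists_openNormalSubgroup_forall_mul_ne PH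
    (isClosed_range_piHToPi 𝒢 H ⟨v, hvH⟩ F) hgPH
  -- (2) `B(𝒢)` is a Galois category, `ρ_v ⋙ F` a fibre functor
  obtain ⟨instG, hfib⟩ := bOf_galoisCategory_holds 𝒢 hc
  letI := instG
  obtain ⟨instF⟩ := hfib v F
  -- (3) a pointed Galois object `(A, a)` with `Stab(a) ⊆ N`
  obtain ⟨X, -, hX⟩ := (nhds_one_has_basis_stabilizers (𝒢.ρ v ⋙ F)).mem_iff.1
    (N.toOpenSubgroup.isOpen.mem_nhds (one_mem N))
  haveI : IsGalois X.obj := X.isGalois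
  -- (4) the SUPPLIED covering for `A := X.obj`, together with (D3) for it
  obtain ⟨𝒢', φ, hφ, hB, hal, hD3φ⟩ := hsup 𝒢 X.obj hc ⟨v⟩ X.isGalois
  have hc' : 𝒢'.IsConnected := covering_isConnected_holds 𝒢 𝒢' φ X.obj hc hφ inferInstance
  have hg' : 𝒢'.IsGraphOfAnabelioids := isGraphOfAnabelioids_of_isProper φ hφ.1 hg
  have hq' : 𝒢'.IsQuasiCoherent := covering_isQuasiCoherent_holds 𝒢 𝒢' φ X.obj hc hc' hφ hal hq
  -- (5) a vertex `v'` over `v`, basepoints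
  obtain ⟨v', hv'⟩ := covering_vertexMap_surjective_holds 𝒢 𝒢' φ X.obj hc hφ inferInstance v
  subst hv'
  let F' : 𝒢'.V v' ⥤ FintypeCat.{v₁} := GaloisCategory.getFiberFunctor (𝒢'.V v')
  obtain ⟨instFF⟩ := covering_fiberFunctor_holds 𝒢 𝒢' φ X.obj hc hφ v' F'
  obtain ⟨e⟩ := nonempty_iso_of_fiberFunctor ((φ.φV v').pullback ⋙ F') F
  have hel' : 𝒢'.IsElevated v' := covering_isElevated_holds 𝒢 𝒢' φ X.obj hc hc' hφ hB hal hq v' (hel ⟨_, hvH⟩)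
  -- (6) decomposition group `Π' = Stab(x₀) = Stab(a) ⊆ N`
  obtain ⟨x₀, hinj, hrange⟩ := covering_decompositionGroup_holds 𝒢 𝒢' φ X.obj hc hc' hφ hB v' F' F e
  -- (7) the components of `φ⁻¹(ℍ)` ↔ `Π_ℍ \ Π_𝒢 / Π'`
  obtain ⟨d, hbij, ⟨K₀, hK₀⟩, hbase, hgrp⟩ :=
    hD3φ hc' v' F' F e H hH hHg hvH x₀ hrange
  -- the covering homomorphism `ι : Π_{𝒢'} → Π_𝒢`
  set ι : 𝒢'.Pi v' F' →* 𝒢.Pi (φ.base.vertexMap v') F :=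
    (Aut.autMulEquivOfIso (Functor.isoWhiskerLeft (𝒢.ρ (φ.base.vertexMap v')) e)).toMonoidHom.comp
      (pi1Map φ.pullbackFunctor (𝒢'.ρ v' ⋙ F')) with hι
  have hstab : MulAction.stabilizer (𝒢.Pi (φ.base.vertexMap v') F) x₀ =
      MulAction.stabilizer (𝒢.Pi (φ.base.vertexMap v') F) X.pt :=
    stabilizer_eq_of_isGalois (𝒢.ρ (φ.base.vertexMap v') ⋙ F) X.obj x₀ X.pt
  have hPiN : ∀ q ∈ ι.range, q ∈ N := fun q hq => by
    apply hX
    rw [← hstab, ← hrange]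
    exact hq
  obtain ⟨-, hQ₀⟩ := hbase K₀ hK₀
  have hgN : ∀ p ∈ PH, ∀ q ∈ ι.range, g ≠ p * 1 * q := fun p hp q hq hgeq =>
    hN p hp q (hPiN q hq) (by rw [hgeq, mul_one])
  -- every vertex of a component is elevated (D6)
  have helev : ∀ (K : {K : 𝒢'.graph.Subgraph // φ.IsPreimageComponent H K}) (u : 𝒢'.graph.Vertex),
      u ∈ K.1.verts → 𝒢'.IsElevated u := fun K u hu =>
    covering_isElevated_holds 𝒢 𝒢' φ X.obj hc hc' hφ hB hal hq u (hel ⟨_, K.2.2.2.2.1 hu⟩)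
  -- (8) a reading of the group of each component: `ι(Π_K) = Π' ∩ g_K⁻¹ Π_ℍ g_K` (untied (D3)),
  --     with `g_K = 1` when `v' ∈ K` (base clause)
  obtain ⟨instG', hfib'⟩ := bOf_galoisCategory_holds 𝒢' hc'
  have hread : ∀ K : {K : 𝒢'.graph.Subgraph // φ.IsPreimageComponent H K},
      ∃ (w : K.1.toSemiGraph.Vertex) (F'' : 𝒢'.V w.1 ⥤ FintypeCat.{v₁}) (_ : FiberFunctor F'')
        (α : 𝒢'.ρ w.1 ⋙ F'' ≅ 𝒢'.ρ v' ⋙ F') (g₁ : 𝒢.Pi (φ.base.vertexMap v') F),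
        (ι.comp ((Aut.autMulEquivOfIso α).toMonoidHom.comp (𝒢'.piHToPi K.1 w F''))).range =
            ι.range ⊓ ConjAct.toConjAct g₁⁻¹ • PH ∧ (v' ∈ K.1.verts → g₁ = 1) := by
    intro K
    by_cases hK : v' ∈ K.1.verts
    · refine ⟨⟨v', hK⟩, F', inferInstance, Iso.refl _, 1, ?_, fun _ => rfl⟩
      have hid : (Aut.autMulEquivOfIso (Iso.refl (𝒢'.ρ v' ⋙ F'))).toMonoidHom = MonoidHom.id _ := by
        ext f : 1
        apply Aut.ext
        simp [Aut.autMulEquivOfIso]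
      rw [hid, MonoidHom.id_comp, (hbase K hK).2, inv_one, map_one, one_smul]
    · obtain ⟨w, hw⟩ := K.2.2.2.1
      let F'' : 𝒢'.V w ⥤ FintypeCat.{v₁} := GaloisCategory.getFiberFunctor (𝒢'.V w)
      obtain ⟨α⟩ : Nonempty (𝒢'.ρ w ⋙ F'' ≅ 𝒢'.ρ v' ⋙ F') := by
        letI := instG'
        obtain ⟨i1⟩ := hfib' w F''
        obtain ⟨i2⟩ := hfib' v' F'
        exact nonempty_iso_of_fiberFunctor' _ _
      obtain ⟨g₁, hg₁⟩ := hgrp K ⟨w, hw⟩ F'' α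
      exact ⟨⟨w, hw⟩, F'', inferInstance, α, g₁, hg₁, fun h => absurd h hK⟩
  choose wK FK instK αK gK hgK hgK1 using hread
  -- (9) KEY (Prop. 2.6): two components with a vertex of the first outside the second have
  --     readings in DISTINCT double cosets `Π_ℍ g_K Π'`
  have hkey : ∀ K K' : {K : 𝒢'.graph.Subgraph // φ.IsPreimageComponent H K},
      (∃ u ∈ K.1.verts, u ∉ K'.1.verts) →
      DoubleCoset.mk PH ι.range (gK K) = DoubleCoset.mk PH ι.range (gK K') → False := by
    intro K K' ⟨u, huK, huK'⟩ hcl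
    haveI := instK K
    haveI := instK K'
    rw [DoubleCoset.eq] at hcl
    obtain ⟨p, hp, q, hq, hgeq⟩ := hcl
    obtain ⟨γ, hγ⟩ : ∃ γ : 𝒢'.Pi v' F', ι γ = q⁻¹ := ι.range.inv_mem hq
    -- the two readings, as subgroups of `Π_{𝒢'}`
    set AK : Subgroup (𝒢'.Pi v' F') :=
      ((Aut.autMulEquivOfIso (αK K)).toMonoidHom.comp (𝒢'.piHToPi K.1 (wK K) (FK K))).range
      with hAK
    set AK' : Subgroup (𝒢'.Pi v' F') :=
      ((Aut.autMulEquivOfIso (αK K')).toMonoidHom.comp (𝒢'.piHToPi K'.1 (wK K') (FK K'))).range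
      with hAK'
    have hA : AK.map ι = ι.range ⊓ ConjAct.toConjAct (gK K)⁻¹ • PH := by
      rw [hAK, ← MonoidHom.range_comp]; exact hgK K
    have hA' : AK'.map ι = ι.range ⊓ ConjAct.toConjAct (gK K')⁻¹ • PH := by
      rw [hAK', ← MonoidHom.range_comp]; exact hgK K'
    -- `ι(A_{K'}) = q⁻¹ ι(A_K) q`, hence `A_{K'} = γ A_K γ⁻¹`
    have hconjA : AK' = ConjAct.toConjAct γ • AK := by
      apply Subgroup.map_injective hinj
      rw [map_conjAct_smul, hγ, hA, hA', hgeq, mul_inv_rev, mul_inv_rev, map_mul, map_mul,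
        mul_smul, mul_smul, conjAct_smul_eq_self_of_mem (PH.inv_mem hp), Subgroup.smul_inf,
        conjAct_smul_eq_self_of_mem (ι.range.inv_mem hq)]
    -- Prop. 2.6 for the pair `(K, K')` at the basepoints `(w_K, F_K)`, `(w_{K'}, F_{K'})`
    obtain ⟨hrel, -⟩ := proposition_2_6_holds 𝒢' hc' hg' hq' K.1 K'.1 K.2.1 K'.2.1 K.2.2.1 K'.2.2.1
      (Or.inl ⟨u, huK, huK', helev K u huK⟩) (wK K) (FK K) (wK K') (FK K')
      (αK K' ≪≫ (αK K).symm)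
    -- transport to `Π_{𝒢'}` along `T := Aut(α_K)`
    set T := Aut.autMulEquivOfIso (αK K) with hT
    have hTcomp : T.toMonoidHom.comp (Aut.autMulEquivOfIso (αK K' ≪≫ (αK K).symm)).toMonoidHom =
        (Aut.autMulEquivOfIso (αK K')).toMonoidHom := by
      ext f : 1
      apply Aut.ext
      simp [hT, Aut.autMulEquivOfIso]
    have hPK : ((𝒢'.piHToPi K.1 (wK K) (FK K)).range).map T.toMonoidHom = AK := by
      rw [hAK, ← MonoidHom.range_comp]
    have hPK' : (((Aut.autMulEquivOfIso (αK K' ≪≫ (αK K).symm)).toMonoidHom.comp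
        (𝒢'.piHToPi K'.1 (wK K') (FK K'))).range).map T.toMonoidHom = AK' := by
      rw [hAK', ← MonoidHom.range_comp, ← MonoidHom.comp_assoc, hTcomp]
    -- `P_{K'} = δ P_K δ⁻¹` with `δ := T⁻¹ γ`
    have hδ : ((Aut.autMulEquivOfIso (αK K' ≪≫ (αK K).symm)).toMonoidHom.comp
        (𝒢'.piHToPi K'.1 (wK K') (FK K'))).range =
        ConjAct.toConjAct (T.symm γ) • (𝒢'.piHToPi K.1 (wK K) (FK K)).range := by
      apply Subgroup.map_injective (f := T.toMonoidHom) T.injective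
      rw [hPK', map_conjAct_smul, hPK, hconjA]
      simp [hT]
    have h0 := hrel (T.symm γ)⁻¹
    rw [hδ, smul_smul, ← map_mul, inv_mul_cancel, map_one, one_smul, Subgroup.relIndex_self]
      at h0
    exact one_ne_zero h0
  -- (10) the readings give an INJECTIVE, hence (by the counting bijection `d`) SURJECTIVE map to
  --      the double cosets; pick the component `K₁` at the double coset of `g`
  have hcinj : Function.Injective
      (fun K : {K : 𝒢'.graph.Subgraph // φ.IsPreimageComponent H K} =>
        DoubleCoset.mk PH ι.range (gK K)) := by
    intro K K' hcl
    by_contra hne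
    by_cases h1 : ∃ u ∈ K.1.verts, u ∉ K'.1.verts
    · exact hkey K K' h1 hcl
    by_cases h2 : ∃ u ∈ K'.1.verts, u ∉ K.1.verts
    · exact hkey K' K h2 hcl.symm
    push Not at h1 h2
    exact hne (Subtype.ext (K.2.eq_of_verts_eq K'.2 (Set.Subset.antisymm h1 h2)))
  haveI : ι.range.FiniteIndex := by
    rw [hrange]
    refine ⟨?_⟩
    rw [MulAction.index_stabilizer]
    exact Nat.pos_iff_ne_zero.mp
      ((Set.ncard_pos (Set.toFinite _)).mpr ⟨x₀, MulAction.mem_orbit_self x₀⟩)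
  haveI : Finite (DoubleCoset.Quotient (PH : Set (𝒢.Pi (φ.base.vertexMap v') F)) ι.range) := by
    refine Finite.of_surjective
      (fun x : 𝒢.Pi (φ.base.vertexMap v') F ⧸ ι.range =>
        Quotient.liftOn' x (DoubleCoset.mk PH ι.range) ?_) ?_
    · intro a b hab
      rw [QuotientGroup.leftRel_apply] at hab
      exact (DoubleCoset.eq PH ι.range a b).2
        ⟨1, PH.one_mem, a⁻¹ * b, hab, by rw [one_mul, mul_inv_cancel_left]⟩
    · intro x
      induction x using Quotient.inductionOn' with
      | h a => exact ⟨QuotientGroup.mk a, rfl⟩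
  haveI : Finite {K : 𝒢'.graph.Subgraph // φ.IsPreimageComponent H K} :=
    (Equiv.ofBijective _ hbij).finite_iff.mpr inferInstance
  obtain ⟨K₁, hK₁⟩ := ((Finite.injective_iff_surjective_of_equiv (Equiv.ofBijective _ hbij)).mp
    hcinj) (DoubleCoset.mk PH ι.range g)
  have hK₁' : DoubleCoset.mk PH ι.range (gK K₁) = DoubleCoset.mk PH ι.range g := hK₁
  -- `v' ∉ K₁`: otherwise `g_{K₁} = 1` and `g ∈ Π_ℍ Π' ⊆ Π_ℍ N`
  have hv'K₁ : v' ∉ K₁.1.verts := by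
    intro hmem
    have h2 := hK₁'
    rw [hgK1 K₁ hmem, DoubleCoset.eq] at h2
    obtain ⟨p, hp, q, hq, hgeq⟩ := h2
    exact hgN p hp q hq hgeq
  -- (11) the reading of `K₁`: `ι(Π_{K₁}) = Π' ∩ g₁⁻¹ Π_ℍ g₁` with `g = p₁ g₁ q₁`
  haveI := instK K₁
  have hQ₁ := hgK K₁
  have hg₁' := hK₁'
  rw [DoubleCoset.eq] at hg₁'
  obtain ⟨p₁, hp₁, q₁, hq₁, hgeq₁⟩ := hg₁'
  -- (12) Proposition 2.6 in `𝒢'` for the components `K₀ ∋ v'` and `K₁ ∌ v'`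
  have h26' := proposition_2_6_holds 𝒢' hc' hg' hq' K₀.1 K₁.1 K₀.2.1 K₁.2.1 K₀.2.2.1 K₁.2.2.1
    (Or.inl ⟨v', hK₀, hv'K₁, hel'⟩) ⟨v', hK₀⟩ F' (wK K₁) (FK K₁) (αK K₁)
  obtain ⟨hrel, -⟩ := h26'
  -- (13) choose `γ ∈ Π_{𝒢'}` with `ι γ = q₁⁻¹` and push the relative index through `ι`
  obtain ⟨γ, hγ⟩ : ∃ γ : 𝒢'.Pi v' F', ι γ = q₁⁻¹ := ι.range.inv_mem hq₁
  have hzero := hrel γ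
  rw [← Subgroup.relIndex_map_map_of_injective _ _ hinj, map_conjAct_smul, hγ,
    ← MonoidHom.range_comp, ← MonoidHom.range_comp, hQ₁, hQ₀] at hzero
  -- (14) … contradicting the commensurability of `g⁻¹ Π_ℍ g` with `Π_ℍ`
  have hcomm : (ConjAct.toConjAct g⁻¹ • PH).relIndex PH ≠ 0 :=
    ((Subgroup.Commensurable.commensurator_mem_iff PH g⁻¹).1
      ((Subgroup.Commensurable.commensurator PH).inv_mem hgC)).1
  exact relIndex_conj_inter_ne_zero PH ι.range hp₁ hq₁ hgeq₁ hcomm hzero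

/-- **[SemiAnbd] Cor. 2.7 (i) (both clauses), from a SUPPLIED covering carrying (D3)**: the named fact
`corollary_2_7_i` (`C_{Π_𝒢}(Π_ℍ) = Π_ℍ` for connected `ℍ` with elevated vertices, and `C_{Π_𝒢}(Π_v) = Π_v`
for elevated `v`) follows; the vertex clause is the sub-semi-graph clause for `ℍ = {v}`
(`range_piHToPi_single`, `single_isConnected`, `single_isGraph`), as in abc-iut-L3-d3's
`corollary_2_7_i_of_dictionary`. [cite: MochizukiSemiAnbd2006, Cor. 2.7(i) p.30] -/
theorem corollary_2_7_i_of_coveringSupply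
    (hsup : ∀ (𝒢 : SemiGraphOfAnabelioids.{v₁, u₁, u}) (A : 𝒢.BObj) (hc : 𝒢.IsConnected),
      Nonempty 𝒢.graph.Vertex → @IsGalois 𝒢.BObj _ (𝒢.galoisCategory_bObj hc) A →
      ∃ (𝒢' : SemiGraphOfAnabelioids.{v₁, u₁, u}) (φ : Hom 𝒢' 𝒢),
        φ.IsFiniteEtaleCoveringOf A ∧ φ.IsGlobalCoveringOf A ∧ φ.IsBranchAligned ∧
        (𝒢'.IsConnected →
          ∀ (v' : 𝒢'.graph.Vertex) (F' : 𝒢'.V v' ⥤ FintypeCat.{v₁}) [FiberFunctor F']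
            (F : 𝒢.V (φ.base.vertexMap v') ⥤ FintypeCat.{v₁}) [FiberFunctor F]
            (e : (φ.φV v').pullback ⋙ F' ≅ F)
            (H : 𝒢.graph.Subgraph), H.toSemiGraph.IsConnected → H.toSemiGraph.IsGraph →
            ∀ (hv : φ.base.vertexMap v' ∈ H.verts),
            let v := φ.base.vertexMap v'
            let ι : 𝒢'.Pi v' F' →* 𝒢.Pi v F :=
              (Aut.autMulEquivOfIso (Functor.isoWhiskerLeft (𝒢.ρ v) e)).toMonoidHom.comp
                (pi1Map φ.pullbackFunctor (𝒢'.ρ v' ⋙ F'))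
            let PH : Subgroup (𝒢.Pi v F) := (𝒢.piHToPi H ⟨v, hv⟩ F).range
            ∀ x₀ : (𝒢.ρ v ⋙ F).obj A, ι.range = MulAction.stabilizer (𝒢.Pi v F) x₀ →
              ∃ d : {K : 𝒢'.graph.Subgraph // φ.IsPreimageComponent H K} → 𝒢.Pi v F,
                Function.Bijective (fun K => DoubleCoset.mk PH ι.range (d K)) ∧
                (∃ K₀ : {K : 𝒢'.graph.Subgraph // φ.IsPreimageComponent H K}, v' ∈ K₀.1.verts) ∧
                (∀ (K : {K : 𝒢'.graph.Subgraph // φ.IsPreimageComponent H K}) (hK : v' ∈ K.1.verts),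
                  d K ∈ ι.range ∧
                    (ι.comp (𝒢'.piHToPi K.1 ⟨v', hK⟩ F')).range = ι.range ⊓ PH) ∧
                ∀ (K : {K : 𝒢'.graph.Subgraph // φ.IsPreimageComponent H K})
                  (w'' : K.1.toSemiGraph.Vertex) (F'' : 𝒢'.V w''.1 ⥤ FintypeCat.{v₁})
                  [FiberFunctor F''] (α : 𝒢'.ρ w''.1 ⋙ F'' ≅ 𝒢'.ρ v' ⋙ F'),
                  ∃ g : 𝒢.Pi v F,
                    (ι.comp ((Aut.autMulEquivOfIso α).toMonoidHom.comp
                      (𝒢'.piHToPi K.1 w'' F''))).range = ι.range ⊓ ConjAct.toConjAct g⁻¹ • PH)) :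
    corollary_2_7_i.{v₁, u₁, u} := by
  intro 𝒢 hc hg hq
  refine ⟨fun H hH hHg hel w F _ => ?_, fun v hv F _ => ?_⟩
  · exact isCommensurablyTerminal_piHToPi_of_coveringSupply hsup 𝒢 hc hg hq H hH hHg hel w.1 w.2 F
  · have h := isCommensurablyTerminal_piHToPi_of_coveringSupply hsup 𝒢 hc hg hq ⟨{v}, ∅⟩
      (single_isConnected 𝒢 v) (single_isGraph 𝒢 v) (fun w => ?_) v (Set.mem_singleton v) F
    · rwa [range_piHToPi_single] at h
    · obtain ⟨w, hw⟩ := w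
      cases hw
      exact hv

end SemiGraphOfAnabelioids

end Literature.AnabelianGeometry.SemiGraphs
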